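import Literature.AlgebraicTopology.KTheory.Clutching
import Literature.AlgebraicTopology.KTheory.Products
import Literature.AlgebraicTopology.KTheory.Collapse
import HarnessLib

/-!
# The exact sequence `K̃(X/A) → K⁰(X) → K⁰(A)` of a compact pair

For a compact Hausdorff space `X` and a closed subspace `A` (`A : Closeds X`, quotient
`Collapse X A = X/A` with base point `pt`), the sequence
`K̃⁰(X/A) —q^*→ K⁰(X) —i^*→ K⁰(A)` is exact at `K⁰(X)` (Hatcher, *Vector Bundles and K-Theory*,
Prop. 2.9; Husemöller, *Fibre Bundles*, Ch. 10 Prop. 2.1 and Cor. 2.2), in the idempotent model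
`K⁰ = K₀(C(-, ℂ))`:

* `pullback_const` — pull-back along a constant map is `rank • [1]`; hence
  `resK_quotK : i^* q^* b = rank_{pt}(b) • [1]` and `i^* q^* = 0` on `K̃⁰(X/A)`
  (`resK_quotK_of_mem_reduced`);
* `descendMatrix` — matrices over `C(X, ℂ)` constant on `A` descend to `C(X/A, ℂ)`
  (`Collapse.lift` entrywise), `matrix_eq_of_map_mk_eq`;
* **`exists_idem_collapse_of_algEquivalent_const`** (descent lemma) — if `P|_A ∼ E` with `E` a
  *constant* idempotent, then `P ∼ q^* q` for an idempotent `q` over `X/A` with `q(pt) ∼ E`: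
  the involution `w` of `AlgEquivalent.exists_involution_conj` conjugates `P|_A ⊕ 0` to the
  constant `0 ⊕ E`, a Whitehead lift `L` of `w ⊕ w` over `X` (Tietze, `Clutching.lean`) gives
  `Q = L⁻¹ (P ⊕ 0 ⊕ 0) L ∼ P` with `Q|_A` constant, and `Q` descends;
* **`exists_idem_collapse_of_restrict`** (stable form) — if `[p|_A] = [1ᵣ]` in `K⁰(A)` then
  `1ₘ ⊕ p ∼ q^* q` with `rank_{pt} q = m + r`;
* **`exists_reduced_quotK_eq`** — exactness: `i^* a = 0 ⇒ a = q^* b` with `b ∈ K̃⁰(X/A)`.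

Everything is proved; no named facts.

## References

* D. Husemöller, *Fibre Bundles*, 3rd ed., GTM 20 (1994) [HusemollerFibreBundles1994] (held as
  `book:husemollernd-fibre-bundles`, PDF pp. 147–149): Ch. 10 §1 (collapsing `ξ/t` of a bundle
  trivialised over `A`), Prop. 2.1 (`K̃(X/A) → K̃(X) → K̃(A)` exact; proof: "`(ξ ⊕ θᵏ)/t` is a
  vector bundle over `X/A` whose induced bundle over `X` is s-equivalent to `ξ`"), Cor. 2.2
  (`K(X, A) → K(X) → K(A)` exact).
* A. Hatcher, *Vector Bundles and K-Theory* (v2.2, 2017), Prop. 2.9 (compact Hausdorff pairs; the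
  Tietze-extension proof followed here).

## Design notes

* The source proves Prop. 2.1 for finite CW pairs by extending bundle morphisms cell by cell;
  for compact Hausdorff pairs (Hatcher 2.9) the extension is by Tietze. In the matrix model the
  trivialisation is the involution `w` (so that `w ⊕ w⁻¹ = w ⊕ w` lifts by Whitehead's lemma with
  no homotopy-extension argument), and "collapsing" is `descendMatrix`.
* Hypotheses: `[CompactSpace X] [T2Space X]` (normality for Tietze; `X/A` is then compact
  Hausdorff by `Collapse.lean`).
* Not here: the continuation of the sequence to the left (`K̃(SA) → K̃(X/A)`), Lemma 2.10
  (quotients by contractible subspaces), products.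
-/

noncomputable section

namespace Literature.AlgebraicTopology.KTheory

open Literature.RingTheory.KTheory Matrix Set TopologicalSpace

universe u

variable {X : Type u} [TopologicalSpace X]

/-! ### The pair `(X, A)`: restriction and quotient -/

variable (A : Closeds X)

/-- Restriction to the closed subspace: `i^* : K⁰(X) → K⁰(A)`. [folklore] -/
abbrev resK : K0 X →+ K0 (A : Set X) := pullback (incl (A : Set X))

/-- Pull-back along the collapse: `q^* : K⁰(X/A) → K⁰(X)`. [folklore] -/
abbrev quotK : K0 (Collapse X A) →+ K0 X := pullback (Collapse.mk A)

/-- `A → X → X/A` is the constant map to the base point. [folklore] -/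
theorem mk_comp_incl : (Collapse.mk A).comp (incl (A : Set X)) = ContinuousMap.const _ (Collapse.pt A) :=
  ContinuousMap.ext fun a ↦ Collapse.mk_eq_pt a.2

/-- **The composite `A → X → X/A` is constant**, so `i^* q^* b = rank_{pt}(b) • [1]`; in
particular `i^* q^*` kills `K̃(X/A)`. [cite: HusemollerFibreBundles1994, Ch. 10 Prop. 2.1] -/
theorem resK_quotK (b : K0 (Collapse X A)) :
    resK A (quotK A b) = KZero.unitHom _ (rankAt (Collapse.pt A) b) := by
  rw [resK, quotK, ← AddMonoidHom.comp_apply, ← pullback_comp, mk_comp_incl, pullback_const]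

/-- `i^* q^* = 0` on the reduced group `K̃⁰(X/A)`. [cite: HusemollerFibreBundles1994, Ch. 10 Prop. 2.1] -/
theorem resK_quotK_of_mem_reduced {b : K0 (Collapse X A)} (hb : b ∈ Reduced (Collapse X A) (Collapse.pt A)) :
    resK A (quotK A b) = 0 := by
  rw [resK_quotK, mem_reduced_iff.1 hb, map_zero]

/-! ### Descent of matrices constant on `A` to `X/A` -/

section Descend

variable {A}

/-- A matrix over `C(X/A, ℂ)` is determined by its pull-back to `X` and its value at the base
point. [folklore] -/
theorem matrix_eq_of_map_mk_eq {m n : Type*} {M N : Matrix m n C(Collapse X A, ℂ)}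
    (h : M.map (comapRingHom (Collapse.mk A)) = N.map (comapRingHom (Collapse.mk A)))
    (hpt : M.map (evalRingHom (Collapse.pt A)) = N.map (evalRingHom (Collapse.pt A))) : M = N := by
  ext i j z : 3
  rcases Collapse.eq_pt_or_eq_mk z with rfl | ⟨x, -, rfl⟩
  · exact congrFun (congrFun hpt i) j
  · exact congrFun (congrArg DFunLike.coe (congrFun (congrFun h i) j)) x

/-- Descend a matrix of functions constant on `A` (with values `C₀`) to `X/A`. [folklore] -/
def descendMatrix {m n : Type*} (M : Matrix m n C(X, ℂ)) (C₀ : Matrix m n ℂ)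
    (hM : ∀ i j, ∀ a ∈ A, M i j a = C₀ i j) : Matrix m n C(Collapse X A, ℂ) :=
  Matrix.of fun i j ↦ Collapse.lift (M i j) (C₀ i j) (hM i j)

/-- The descended matrix pulls back to the original one. [folklore] -/
theorem descendMatrix_map_mk {m n : Type*} (M : Matrix m n C(X, ℂ)) (C₀ : Matrix m n ℂ) (hM) :
    (descendMatrix M C₀ hM : Matrix m n C(Collapse X A, ℂ)).map (comapRingHom (Collapse.mk A)) = M := by
  ext i j x : 3; rfl

/-- The descended matrix has the prescribed value at the base point. [folklore] -/
theorem descendMatrix_map_eval_pt {m n : Type*} (M : Matrix m n C(X, ℂ)) (C₀ : Matrix m n ℂ) (hM) :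
    (descendMatrix M C₀ hM : Matrix m n C(Collapse X A, ℂ)).map (evalRingHom (Collapse.pt A)) = C₀ := by
  ext i j : 2; rfl

/-- Descent preserves idempotency. [folklore] -/
theorem isIdempotentElem_descendMatrix {m : Type*} [Fintype m] {M : Matrix m m C(X, ℂ)} {C₀ : Matrix m m ℂ}
    (hM : IsIdempotentElem M) (hC : IsIdempotentElem C₀) (h) :
    IsIdempotentElem (descendMatrix M C₀ h : Matrix m m C(Collapse X A, ℂ)) :=
  matrix_eq_of_map_mk_eq (by rw [Matrix.map_mul, descendMatrix_map_mk, hM.eq])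
    (by rw [Matrix.map_mul, descendMatrix_map_eval_pt, hC.eq])

/-- The condition "constant on `A` with values `C₀`" in terms of restriction. [folklore] -/
theorem apply_eq_of_map_resHom_eq {m n : Type*} {M : Matrix m n C(X, ℂ)} {C₀ : Matrix m n ℂ}
    (h : M.map (resHom (A : Set X)) = C₀.map (constRingHom (A : Set X))) (i : m) (j : n) (a : X) (ha : a ∈ A) :
    M i j a = C₀ i j :=
  congrFun (congrArg DFunLike.coe (congrFun (congrFun h i) j)) ⟨a, ha⟩

end Descend

/-! ### The descent lemma (core of Hatcher 2.9 / 2.10, Husemöller 10(2.1)) -/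

section Main

variable {A} [CompactSpace X] [T2Space X]

/-- The constant matrix `(0 ⊕ E) ⊕ 0`. [folklore] -/
def corner (N : Type*) {M : Type*} (E : Matrix M M ℂ) : Matrix ((N ⊕ M) ⊕ (N ⊕ M)) ((N ⊕ M) ⊕ (N ⊕ M)) ℂ :=
  Matrix.fromBlocks (Matrix.fromBlocks 0 0 0 E) 0 0 0

omit [TopologicalSpace X] [CompactSpace X] [T2Space X] in
/-- `(0 ⊕ E) ⊕ 0` is idempotent if `E` is. [folklore] -/
theorem isIdempotentElem_corner (N : Type*) {M : Type*} [Fintype N] [Fintype M] {E : Matrix M M ℂ}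
    (hE : IsIdempotentElem E) : IsIdempotentElem (corner N E) :=
  isIdempotentElem_fromBlocks (isIdempotentElem_fromBlocks IsIdempotentElem.zero hE) IsIdempotentElem.zero

omit [TopologicalSpace X] [CompactSpace X] [T2Space X] in
/-- `(0 ⊕ E) ⊕ 0 ∼ E`. [folklore] -/
theorem algEquivalent_corner (N : Type*) {M : Type*} [Fintype N] [Fintype M] {E : Matrix M M ℂ}
    (hE : IsIdempotentElem E) : AlgEquivalent (corner N E) E :=
  ((AlgEquivalent.fromBlocks_zero (isIdempotentElem_fromBlocks IsIdempotentElem.zero hE)).trans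
    (AlgEquivalent.fromBlocks_comm IsIdempotentElem.zero hE)).trans (AlgEquivalent.fromBlocks_zero hE)

/-- **Descent lemma** (the common core of Hatcher, *VBKT* Prop. 2.9 and Lemma 2.10; Husemöller,
Ch. 10 Prop. 2.1, in the idempotent model). Let `X` be compact Hausdorff, `A ⊆ X` closed, `P` an
idempotent matrix over `C(X, ℂ)` whose restriction to `A` is algebraically equivalent to a
*constant* idempotent `E`. Then `P` is algebraically equivalent to the pull-back of an idempotent
`q` over `X/A` whose fibre at the base point is equivalent to `E`. Construction: the involution
`w` of `exists_involution_conj` conjugates `P|_A ⊕ 0` to the constant `0 ⊕ E`; a Whitehead lift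
`L` of `w ⊕ w` over `X` (Tietze) gives `Q = L⁻¹ (P ⊕ 0 ⊕ 0) L ∼ P` with `Q|_A = (0 ⊕ E) ⊕ 0`
constant, and `Q` descends to `X/A`. [cite: HusemollerFibreBundles1994, Ch. 10 Prop. 2.1] -/
theorem exists_idem_collapse_of_algEquivalent_const {n : Type*} [Fintype n] [DecidableEq n]
    {k : Type*} [Fintype k] [DecidableEq k]
    {P : Matrix n n C(X, ℂ)} (hP : IsIdempotentElem P) {E : Matrix k k ℂ} (hE : IsIdempotentElem E)
    (hPE : AlgEquivalent (P.map (resHom (A : Set X))) (E.map (constRingHom (A : Set X)))) :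
    ∃ q : Idem C(Collapse X A, ℂ),
      AlgEquivalent (q.mat.map (comapRingHom (Collapse.mk A))) P ∧
        AlgEquivalent (q.mat.map (evalRingHom (Collapse.pt A))) E := by
  classical
  set ρ : C(X, ℂ) →+* C((A : Set X), ℂ) := resHom (A : Set X)
  -- the involution over `A`
  obtain ⟨w, hww, hconj⟩ := hPE.exists_involution_conj
  -- Whitehead lift of `w ⊕ w` over `X`
  obtain ⟨a, ha⟩ := matrix_map_resHom_surjective A.isClosed w
  obtain ⟨b, hb⟩ := matrix_map_resHom_surjective A.isClosed (-w)
  obtain ⟨L, L', hLL', hL'L, hLρ⟩ := exists_lift_fromBlocks ρ hww hww ha hb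
  have hL'ρ : L'.map ρ = Matrix.fromBlocks w 0 0 w := by
    have h2 : L'.map ρ * Matrix.fromBlocks w 0 0 w = 1 := by
      rw [← hLρ, ← Matrix.map_mul, hL'L, Matrix.map_one _ ρ.map_zero ρ.map_one]
    have h3 : Matrix.fromBlocks w 0 0 w * Matrix.fromBlocks w 0 0 w =
        (1 : Matrix _ _ C((A : Set X), ℂ)) := fromBlocks_diag_mul_fromBlocks_diag w w hww hww
    calc L'.map ρ = L'.map ρ * (Matrix.fromBlocks w 0 0 w * Matrix.fromBlocks w 0 0 w) := by
          rw [h3, Matrix.mul_one]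
      _ = Matrix.fromBlocks w 0 0 w := by rw [← Matrix.mul_assoc, h2, Matrix.one_mul]
  -- the conjugated idempotent over `X`
  set B : Matrix ((n ⊕ k) ⊕ (n ⊕ k)) _ C(X, ℂ) := Matrix.fromBlocks (Matrix.fromBlocks P 0 0 0) 0 0 0
  have hB : IsIdempotentElem B :=
    isIdempotentElem_fromBlocks (isIdempotentElem_fromBlocks hP IsIdempotentElem.zero) IsIdempotentElem.zero
  set Q := L' * B * L
  have hQ : AlgEquivalent B Q := AlgEquivalent.conj hB hLL'
  have hQρ : Q.map ρ = (corner n E).map (constRingHom (A : Set X)) := by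
    have hBρ : B.map ρ = Matrix.fromBlocks (Matrix.fromBlocks (P.map ρ) 0 0 0) 0 0 0 := by
      simp only [B, Matrix.fromBlocks_map, Matrix.map_zero _ ρ.map_zero]
    rw [show Q = L' * B * L from rfl, Matrix.map_mul, Matrix.map_mul, hL'ρ, hLρ, hBρ]
    simp only [corner, Matrix.fromBlocks_multiply, Matrix.fromBlocks_map, Matrix.map_zero _ (map_zero _),
      Matrix.mul_zero, Matrix.zero_mul, add_zero]
    rw [hconj]
  -- descend
  have hconst := apply_eq_of_map_resHom_eq hQρ
  set Qbar : Matrix _ _ C(Collapse X A, ℂ) := descendMatrix Q (corner n E) hconst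
  have hQbar : IsIdempotentElem Qbar :=
    isIdempotentElem_descendMatrix hQ.isIdempotentElem_right (isIdempotentElem_corner _ hE) hconst
  refine ⟨Idem.ofMatrix Qbar hQbar, ?_, ?_⟩
  · change AlgEquivalent ((Matrix.reindex _ _ Qbar).map (comapRingHom (Collapse.mk A))) P
    rw [Matrix.reindex_apply, ← Matrix.submatrix_map, descendMatrix_map_mk]
    refine (AlgEquivalent.submatrix hQ.isIdempotentElem_right _).symm.trans (hQ.symm.trans ?_)
    exact (AlgEquivalent.fromBlocks_zero (isIdempotentElem_fromBlocks hP IsIdempotentElem.zero)).trans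
      (AlgEquivalent.fromBlocks_zero hP)
  · change AlgEquivalent ((Matrix.reindex _ _ Qbar).map (evalRingHom (Collapse.pt A))) E
    rw [Matrix.reindex_apply, ← Matrix.submatrix_map, descendMatrix_map_eval_pt]
    exact (AlgEquivalent.submatrix (isIdempotentElem_corner _ hE) _).symm.trans (algEquivalent_corner _ hE)

/-- **Stable form** (Hatcher, *VBKT* Prop. 2.9; Husemöller, Ch. 10 Prop. 2.1): if `[p|_A] = [1ᵣ]` in
`K⁰(A)` (the restriction is *stably* trivial of rank `r`), then after adding a free summand `1ₘ`
the idempotent `p` is algebraically equivalent to the pull-back of an idempotent `q` over `X/A`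
of rank `m + r` at the base point. [cite: HusemollerFibreBundles1994, Ch. 10 Prop. 2.1] -/
theorem exists_idem_collapse_of_restrict (p : Idem C(X, ℂ)) (r : ℕ)
    (hp : KZero.of (p.map (resHom (A : Set X))) = KZero.of (Idem.unit r)) :
    ∃ (m : ℕ) (q : Idem C(Collapse X A, ℂ)),
      q.map (comapRingHom (Collapse.mk A)) ≈ Idem.unit m + p ∧
        (q.map (evalRingHom (Collapse.pt A))).rank = m + r := by
  set ρ : C(X, ℂ) →+* C((A : Set X), ℂ) := resHom (A : Set X)
  obtain ⟨m, hm⟩ := KZero.of_eq_of_iff_exists_unit.1 hp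
  rw [Idem.unit_add_unit] at hm
  set p' : Idem C(X, ℂ) := Idem.unit m + p
  have hp'ρ : p'.map ρ = Idem.unit m + p.map ρ := by
    rw [Idem.map_add, Idem.map_unit]
  have h1 : AlgEquivalent (p'.mat.map ρ)
      ((1 : Matrix (Fin (m + r)) (Fin (m + r)) ℂ).map (constRingHom (A : Set X))) := by
    rw [Matrix.map_one _ (map_zero _) (map_one _)]
    have := Idem.equiv_iff.1 hm
    rw [← hp'ρ] at this
    exact this
  obtain ⟨q, hq, hqpt⟩ := exists_idem_collapse_of_algEquivalent_const p'.isIdempotentElem IsIdempotentElem.one h1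
  exact ⟨m, q, hq, Idem.rank_eq_iff.2 hqpt⟩

/-- **Exactness of `K̃(X/A) →q^* K(X) →i^* K(A)` at `K(X)`** (Hatcher, *VBKT* Prop. 2.9;
Husemöller, Ch. 10 Prop. 2.1 / Cor. 2.2): for compact Hausdorff `X` and closed `A`, an element of
`K⁰(X)` restricting to `0` in `K⁰(A)` is the pull-back of a reduced element of `K⁰(X/A)`. (The
composite is zero by `resK_quotK_of_mem_reduced`.) [cite: HusemollerFibreBundles1994, Ch. 10 Prop. 2.1] -/
theorem exists_reduced_quotK_eq (a : K0 X) (ha : resK A a = 0) :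
    ∃ b ∈ Reduced (Collapse X A) (Collapse.pt A), quotK A b = a := by
  obtain ⟨p, p₀, rfl⟩ := KZero.exists_of_sub_of a
  -- rewrite `a = [p ⊕ (1 - p₀)] - [1_N]`
  set N := p₀.size
  have ha' : KZero.of p - KZero.of p₀ = KZero.of (p + p₀.compl) - KZero.of (Idem.unit N : Idem C(X, ℂ)) := by
    rw [KZero.of_add, ← KZero.of_add_of_compl p₀]; abel
  have hres : KZero.of ((p + p₀.compl).map (resHom (A : Set X))) = KZero.of (Idem.unit N) := by
    have h := ha
    rw [ha', map_sub, sub_eq_zero, pullback_of, pullback_of, Idem.map_unit] at h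
    exact h
  obtain ⟨m, q, hq, hrank⟩ := exists_idem_collapse_of_restrict (p + p₀.compl) N hres
  refine ⟨KZero.of q - KZero.unitHom _ (m + N : ℕ), ?_, ?_⟩
  · rw [mem_reduced_iff, map_sub, rankAt_of, hrank, rankAt_unitHom, sub_self]
  · have hq' : KZero.of (q.map (comapRingHom (Collapse.mk A))) = KZero.of (Idem.unit m + (p + p₀.compl)) :=
      KZero.of_eq_of hq
    rw [map_sub, pullback_of, hq', pullback_unitHom, KZero.of_add, KZero.of_unit_eq_unitHom, ha',
      KZero.of_unit_eq_unitHom, Nat.cast_add, map_add]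
    abel

end Main

end Literature.AlgebraicTopology.KTheory

end
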